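import Mathlib.Analysis.Calculus.MeanValue
import Mathlib.Topology.MetricSpace.Thickening
import Mathlib.Topology.UniformSpace.HeineCantor
import Mathlib.Analysis.Normed.Group.Bounded
import HarnessLib

/-!
# Lyapunov functions for the asymptotic stability of a compact SET modulo an exceptional set:
# decay of the dissipation rate, attraction dichotomy, sublevel region of attraction, stability
# (Groß–Colombino–Brouillon–Dörfler 2019, Thm. 1; mechanism: Salvadori's theorem,
# Rouche–Habets–Laloy Ch. I Thm. 6.23)

Topic `Literature/Analysis/ODE`, namespace `Literature.Analysis.ODE`, grouping sub-namespace = the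
hypothesis structure `DissipativeCurve` (dot notation). Pure analysis, autonomous equations
`ẋ = F(x)` on a real normed space, in the tree's flow-free "a priori" phrasing: every statement is
about ONE curve `X : ℝ → E` solving the equation on `[0, ∞)` (`HasDerivWithinAt X (F (X t)) (Ici 0) t`,
the convention of `Literature.MathematicalPhysics.PowerSystems.*.IsSolutionOn γ (Ici 0)`), along
which a function `V` has a derivative `≤ -D (X t)` with a continuous DISSIPATION RATE `D ≥ 0`, and
which stays in a compact set `K`. No flow, no uniqueness, no limit sets, no comparison-function
(class-`𝒦`) bookkeeping, 0 definitions of `Prop` facts: everything is PROVED.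

Sources (held, read on the page):
* [GrossEtAl2019] D. Groß, M. Colombino, J.-S. Brouillon, F. Dörfler, *The effect of transmission-line
  dynamics on grid-forming dispatchable virtual oscillator control*, IEEE TCNS 6 (2019) = arXiv:1802.08881,
  §III Definition 3 and **Theorem 1 (Lyapunov function)** p. 4, proof in the Appendix pp. 10–11.
* [RoucheHabetsLaloy1977] N. Rouche, P. Habets, M. Laloy, *Stability Theory by Liapunov's Direct Method*,
  Springer 1977, Ch. I §6: Thm. 6.2 (a) and its proof ("`V(t,x(t)) ≤ V(t₀,x₀) - ∫ c(‖x(s)‖) ds ≤ b(α)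
  - c(η)σ < 0`, which contradicts (i)") and **Thm. 6.23 (L. Salvadori 1972)** with its proof (the
  two-case argument: "`W(t,x(t)) ≥ k` for every `t ≥ t₀ + σ` … `V → -∞`"; "two increasing sequences
  … `W(tᵢ, x(tᵢ)) = k`, `W(tᵢ', x(tᵢ')) = k/2` … `tᵢ' - tᵢ ≥ k/2M` … `V(tₙ',x(tₙ')) ≤ V(t₀,x(t₀)) -
  n c(k/2) k/(2M)` … negative for `n` large enough").

> [GrossEtAl2019, Thm. 1] «Consider a Lipschitz continuous function f : ℝⁿ → ℝⁿ, a compact set 𝒞 ⊂ ℝⁿ,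
> and an invariant set 𝒰 ⊂ ℝⁿ … such that 𝒞 ∩ 𝒰 = ∅. Moreover, consider a continuously differentiable
> function V : ℝⁿ → ℝ_{>0} and comparison functions χ₁, χ₂ ∈ 𝒦∞ and χ₃ ∈ 𝒦 such that
> χ₁(‖x‖_𝒞) ≤ V(x) ≤ χ₂(‖x‖_𝒞), (d/dt)V(x) := (∂V/∂x) f(x) ≤ −χ₃(‖x‖_{𝒞 ∪ 𝒰}) holds for all
> x ∈ ℝⁿ. Moreover, let Z_𝒰 … denote the region of attraction of 𝒰. If Z_𝒰 has zero Lebesgue measure,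
> the dynamics (d/dt)x = f(x) are almost globally asymptotically stable with respect to 𝒞.»
> [proof, App.] «It follows from χ₃ ∈ 𝒦 that (d/dt)V ≤ 0 … χ₁(‖φ_f(t,x₀)‖_𝒞) ≤ V(φ_f(t,x₀)) ≤ V(x₀) ≤
> χ₂(‖x₀‖_𝒞) … 𝒞 is Lyapunov stable … for x₀ ∉ {Z_𝒰 ∪ 𝒞} and for all t such that φ_f(t,x₀) ∉ 𝒞 it
> holds that (d/dt)V(φ_f(t,x₀)) < 0. Using standard arguments … lim_{t→∞} V(φ_f(t,x₀)) → 0 …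
> ∀x₀ ∉ Z_𝒰 : lim_{t→∞} ‖φ_f(t,x₀)‖_𝒞 = 0 (38).»

## What is proved (the deterministic content of [GrossEtAl2019, Thm. 1], in a priori form)

For a `DissipativeCurve F V D K X` (below) with `K` compact, `F`, `V`, `D` continuous on `K`, `D ≥ 0`
on `K`:
* `norm_sub_le` — speed bound `‖X s − X t‖ ≤ B(s − t)` from `‖F‖ ≤ B` on `K`;
  `apply_le_sub_mul` — `V(X s) ≤ V(X t) − μ(s − t)` when `D(X τ) ≥ μ` on `[t, s)`; `apply_le_apply` —
  `V ∘ X` is non-increasing on `[0, ∞)`;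
* `tendsto_rate` — **the dissipation rate dies out: `D (X t) → 0`** (Salvadori's mechanism,
  [RoucheHabetsLaloy1977, Thm. 6.23]: `D` is uniformly continuous on `K` and `X` has bounded speed,
  so every late time where `D ≥ ε` opens a window of fixed length on which `V` drops by a fixed
  amount; `V` is bounded below on `K`);
* `tendsto_infDist_zeroSet` — hence **`dist(X t, {y ∈ K | D y = 0}) → 0`** (on the compact part of
  `K` at distance `≥ ε` from the zero set, `D` has a positive minimum);
* `tendsto_infDist_or` — **the attraction DICHOTOMY**: if the zero set of `D` in `K` lies in `A ∪ B`
  with `A`, `B` closed and `V ≤ a` on `A ∩ K`, `b ≤ V` on `B ∩ K`, `a < b`, then `dist(X t, A) → 0`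
  or `dist(X t, B) → 0`; and `tendsto_infDist_of_apply_lt` — **the sublevel region of attraction**:
  `V (X 0) < b` forces `dist(X t, A) → 0`. With `A = 𝒞` (the zero set of `V`) and `B = 𝒰` this is
  «∀x₀ ∉ Z_𝒰 : ‖φ_f(t,x₀)‖_𝒞 → 0» in the form the monotonicity of `V` actually yields: a curve that
  does not approach `𝒰` approaches `𝒞`, and every curve starting below the `V`-level of `𝒰` does;
* `exists_forall_infDist_lt` — **Lyapunov stability of the compact zero set `C` of a continuous
  `V ≥ 0` with a compact sublevel set**, uniformly over all curves along which `V` does not increase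
  («𝒞 is Lyapunov stable according to Definition 3»);
* `tendsto_infDist_or_of_disjoint` — the packaged form with `𝒞`, `𝒰` compact and disjoint, `V = 0`
  exactly on `𝒞`: `dist(X t, 𝒞) → 0 ∨ dist(X t, 𝒰) → 0`, and `→ 𝒞` whenever `V(X 0) < min_𝒰 V`;
* §6 (append) `tendsto_comp_of_tendsto_infDist` — READOUTS: a continuous quantity constant on the
  compact set converges to that constant along any curve with `dist(X t, 𝒞) → 0` (proper spaces;
  «they also satisfy all control objectives»).

## Not here (deliberately)

The measure-zero clause «Z_𝒰 has zero Lebesgue measure» / the words «almost globally» (a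
stable-manifold statement about the flow, [GrossEtAl2019] via [24, Prop. 11]); comparison functions
`χᵢ` (replaced by continuity + compactness, which is how the print obtains them, «[23, p. 98]»);
existence of solutions (see `LyapunovSublevelInvariance.exists_global_solution_of_sublevel`). The
Summits-side curve lemmas `Summit.Ventures.GridStability.Lyapunov.tendsto_dissipation_zero` /
`tendsto_infDist_dissipation_zero` (venture GRIDFUSION) prove the first two bullets for their
certificate bridge by the argument of [RoucheHabetsLaloy1977, Thm. 6.2]; Literature cannot import
Summits, and the dichotomy / region-of-attraction / stability statements are new here.
-/

noncomputable section

open Set Filter Metric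
open scoped _root_.Topology

namespace Literature.Analysis.ODE

variable {E : Type*} [NormedAddCommGroup E] [NormedSpace ℝ E]

/-- **A dissipative curve.** `X : ℝ → E` solves `ẋ = F(x)` on `[0, ∞)` (derivative `F (X t)` within
`Ici 0` at every `t ≥ 0`), stays in `K` for `t ≥ 0`, and along it `V` has at every `t ≥ 0` a
derivative (within `Ici 0`) bounded above by `-D (X t)`: the hypotheses «(d/dt)V(x) ≤ −χ₃(‖x‖_{𝒞∪𝒰})»
of [GrossEtAl2019, Thm. 1] / (iii) of [RoucheHabetsLaloy1977, Thm. 6.23] read along one solution,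
with the rate written as a function `D` of the state. [cite: GrossEtAl2019, Thm. 1] -/
structure DissipativeCurve (F : E → E) (V D : E → ℝ) (K : Set E) (X : ℝ → E) : Prop where
  /-- `X` solves `ẋ = F(x)` on `[0, ∞)` -/
  hasDeriv : ∀ t, 0 ≤ t → HasDerivWithinAt X (F (X t)) (Ici 0) t
  /-- `V ∘ X` has a derivative `≤ -D (X t)` at every `t ≥ 0` -/
  lyapunov : ∀ t, 0 ≤ t → ∃ d, HasDerivWithinAt (V ∘ X) d (Ici 0) t ∧ d ≤ -D (X t)
  /-- the forward orbit lies in `K` -/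
  mapsTo : ∀ t, 0 ≤ t → X t ∈ K

namespace DissipativeCurve

variable {F : E → E} {V D : E → ℝ} {K : Set E} {X : ℝ → E}

/-! ### §1 Elementary consequences along the curve: continuity, speed, decrease of `V` -/

/-- A curve differentiable within `[0, ∞)` at every `t ≥ 0` is continuous on `[0, ∞)`. [folklore] -/
private theorem continuousOn (h : DissipativeCurve F V D K X) : ContinuousOn X (Ici 0) :=
  fun t ht => (h.hasDeriv t ht).continuousWithinAt

/-- … and so is `V ∘ X`. [folklore] -/
private theorem continuousOn_comp (h : DissipativeCurve F V D K X) :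
    ContinuousOn (V ∘ X) (Ici 0) := by
  intro t ht
  obtain ⟨d, hd, -⟩ := h.lyapunov t ht
  exact hd.continuousWithinAt

/-- **Speed bound**: if `‖F y‖ ≤ B` on `K`, then `‖X s − X t‖ ≤ B (s − t)` for `0 ≤ t ≤ s`
(mean-value inequality with right derivatives). This is «`tᵢ' − tᵢ ≥ k/2M`» of Salvadori's proof:
bounded speed turns a gap in the values of `D` into a gap in time.
[cite: RoucheHabetsLaloy1977, Ch. I Thm. 6.23 (proof)] -/
theorem norm_sub_le (h : DissipativeCurve F V D K X) {B : ℝ} (hB : ∀ y ∈ K, ‖F y‖ ≤ B)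
    {t s : ℝ} (ht : 0 ≤ t) (hts : t ≤ s) : ‖X s - X t‖ ≤ B * (s - t) := by
  have hc : ContinuousOn X (Icc t s) := h.continuousOn.mono fun τ hτ => ht.trans hτ.1
  have hd : ∀ τ ∈ Ico t s, HasDerivWithinAt X (F (X τ)) (Ici τ) τ := fun τ hτ =>
    (h.hasDeriv τ (ht.trans hτ.1)).mono (Ici_subset_Ici.2 (ht.trans hτ.1))
  have hb : ∀ τ ∈ Ico t s, ‖F (X τ)‖ ≤ B := fun τ hτ => hB _ (h.mapsTo τ (ht.trans hτ.1))
  exact norm_image_sub_le_of_norm_deriv_right_le_segment hc hd hb s (right_mem_Icc.2 hts)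

/-- **Quantified decrease**: if `D (X τ) ≥ μ` for `τ ∈ [t, s)`, then `V (X s) ≤ V (X t) − μ (s − t)`
(«`V(t,x(t)) ≤ V(t₀,x₀) − ∫ c(‖x(s)‖)ds ≤ … − c(η)σ`», integral-free via the boundary comparison
lemma). [cite: RoucheHabetsLaloy1977, Ch. I Thm. 6.2 (proof)] -/
theorem apply_le_sub_mul (h : DissipativeCurve F V D K X) {t s μ : ℝ} (ht : 0 ≤ t) (hts : t ≤ s)
    (hμ : ∀ τ ∈ Ico t s, μ ≤ D (X τ)) : V (X s) ≤ V (X t) - μ * (s - t) := by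
  choose! V' hV' using h.lyapunov
  have hc : ContinuousOn (V ∘ X) (Icc t s) := h.continuousOn_comp.mono fun τ hτ => ht.trans hτ.1
  have hd : ∀ τ ∈ Ico t s, HasDerivWithinAt (V ∘ X) (V' τ) (Ici τ) τ := fun τ hτ =>
    (hV' τ (ht.trans hτ.1)).1.mono (Ici_subset_Ici.2 (ht.trans hτ.1))
  have hBd : ∀ τ ∈ Ico t s, HasDerivWithinAt (fun σ => V (X t) - μ * (σ - t)) (-μ) (Ici τ) τ := by
    intro τ _
    have := ((hasDerivAt_id τ).sub_const t).const_mul μ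
    simpa using (this.const_sub (V (X t))).hasDerivWithinAt
  have hbound : ∀ τ ∈ Ico t s, V' τ ≤ -μ := fun τ hτ =>
    (hV' τ (ht.trans hτ.1)).2.trans (neg_le_neg (hμ τ hτ))
  have := image_le_of_deriv_right_le_deriv_boundary hc hd (B := fun σ => V (X t) - μ * (σ - t))
    (by simp) (by fun_prop) hBd hbound (right_mem_Icc.2 hts)
  simpa using this

/-- **`V` does not increase along the curve**: `V (X s) ≤ V (X t)` for `0 ≤ t ≤ s`, when `D ≥ 0` on
`K` («It follows from χ₃ ∈ 𝒦 that (d/dt)V ≤ 0 … V(φ_f(t,x₀)) ≤ V(x₀)»).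
[cite: GrossEtAl2019, Thm. 1 (proof)] -/
theorem apply_le_apply (h : DissipativeCurve F V D K X) (hD0 : ∀ y ∈ K, 0 ≤ D y) {t s : ℝ}
    (ht : 0 ≤ t) (hts : t ≤ s) : V (X s) ≤ V (X t) := by
  have := h.apply_le_sub_mul ht hts (μ := 0) fun τ hτ => hD0 _ (h.mapsTo τ (ht.trans hτ.1))
  simpa using this

/-! ### §2 Salvadori's theorem: the dissipation rate dies out along the curve -/

/-- **`D (X t) → 0` as `t → ∞`** [cite: RoucheHabetsLaloy1977, Ch. I Thm. 6.23 (Salvadori 1972)],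
for `K` compact, `F`, `V`, `D` continuous on `K` and `D ≥ 0` on `K`. Proof as printed, with
Heine–Cantor in place of the bound on `Ẇ`: if `D (X t) ≥ ε` at arbitrarily late times, uniform
continuity of `D` on `K` and the speed bound give windows `[t, t + h]` of FIXED length on which
`D ≥ ε/2`, so `V` drops by `εh/2` on each; chaining `n` windows (monotonicity in between) drives
`V (X t)` below its minimum on `K`. This is the step «using standard arguments … lim V(φ_f(t,x₀)) → 0»
of [GrossEtAl2019, proof of Thm. 1]. -/
theorem tendsto_rate (h : DissipativeCurve F V D K X) (hK : IsCompact K) (hF : ContinuousOn F K)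
    (hV : ContinuousOn V K) (hD : ContinuousOn D K) (hD0 : ∀ y ∈ K, 0 ≤ D y) :
    Tendsto (fun t => D (X t)) atTop (𝓝 0) := by
  rw [Metric.tendsto_atTop]
  by_contra hcon
  push Not at hcon
  obtain ⟨ε, hε, hfreq⟩ := hcon
  -- late times with `D ≥ ε`
  have hlate : ∀ N : ℝ, ∃ t, N ≤ t ∧ ε ≤ D (X t) := by
    intro N
    obtain ⟨t, hNt, ht⟩ := hfreq (max N 0)
    refine ⟨t, (le_max_left N 0).trans hNt, ?_⟩
    have h0t : 0 ≤ t := (le_max_right N 0).trans hNt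
    rw [Real.dist_eq, sub_zero, abs_of_nonneg (hD0 _ (h.mapsTo t h0t))] at ht
    exact ht
  -- speed bound and uniform continuity of `D`
  obtain ⟨B₀, hB₀⟩ := hK.exists_bound_of_continuousOn hF
  set B : ℝ := |B₀| + 1 with hBdef
  have hBpos : 0 < B := by positivity
  have hFB : ∀ y ∈ K, ‖F y‖ ≤ B := fun y hy => (hB₀ y hy).trans ((le_abs_self _).trans (by linarith))
  obtain ⟨δ, hδ, hδD⟩ := Metric.uniformContinuousOn_iff.1 (hK.uniformContinuousOn_of_continuous hD)
    (ε / 2) (half_pos hε)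
  -- window length and the drop per window
  set hw : ℝ := δ / (2 * B) with hwdef
  have hwpos : 0 < hw := by positivity
  have hdrop : ∀ t, 0 ≤ t → ε ≤ D (X t) → V (X (t + hw)) ≤ V (X t) - ε / 2 * hw := by
    intro t ht hεt
    have key : V (X (t + hw)) ≤ V (X t) - ε / 2 * (t + hw - t) := by
      refine h.apply_le_sub_mul ht (by linarith) fun τ hτ => ?_
      have hτ0 : 0 ≤ τ := ht.trans hτ.1
      have hdist : dist (X τ) (X t) < δ := by
        rw [dist_eq_norm]
        calc ‖X τ - X t‖ ≤ B * (τ - t) := h.norm_sub_le hFB ht hτ.1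
          _ ≤ B * hw := by gcongr; linarith [hτ.2]
          _ = δ / 2 := by rw [hwdef]; field_simp
          _ < δ := by linarith
      have := hδD (X τ) (h.mapsTo τ hτ0) (X t) (h.mapsTo t ht) hdist
      rw [Real.dist_eq] at this
      have := (abs_lt.1 this).1
      linarith
    simpa only [add_sub_cancel_left] using key
  -- `V` is bounded below on `K`
  have hKne : K.Nonempty := ⟨X 0, h.mapsTo 0 le_rfl⟩
  obtain ⟨y₀, hy₀, hmin⟩ := hK.exists_isMinOn hKne hV
  -- chaining `n` windows
  have hchain : ∀ n : ℕ, ∃ t, 0 ≤ t ∧ V (X t) ≤ V (X 0) - n * (ε / 2 * hw) := by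
    intro n
    induction n with
    | zero => exact ⟨0, le_rfl, by simp⟩
    | succ n ih =>
      obtain ⟨t, ht, hVt⟩ := ih
      obtain ⟨t', htt', hεt'⟩ := hlate t
      have ht' : 0 ≤ t' := ht.trans htt'
      refine ⟨t' + hw, by linarith, ?_⟩
      have h1 := hdrop t' ht' hεt'
      have h2 := h.apply_le_apply hD0 ht htt'
      push_cast
      linarith
  -- contradiction with the lower bound
  obtain ⟨n, hn⟩ := exists_nat_gt ((V (X 0) - V y₀) / (ε / 2 * hw))
  obtain ⟨t, ht, hVt⟩ := hchain n
  have hlow : V y₀ ≤ V (X t) := hmin (h.mapsTo t ht)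
  have hc : 0 < ε / 2 * hw := by positivity
  rw [div_lt_iff₀ hc] at hn
  linarith

/-! ### §3 Attraction to the zero set of the dissipation rate -/

/-- The zero set of `D` in `K` is nonempty (for a dissipative curve in a compact `K` with continuous
data): otherwise `D` has a positive minimum on `K ∋ X t`, contradicting `tendsto_rate`. [folklore] -/
private theorem zeroSet_nonempty (h : DissipativeCurve F V D K X) (hK : IsCompact K)
    (hF : ContinuousOn F K)
    (hV : ContinuousOn V K) (hD : ContinuousOn D K) (hD0 : ∀ y ∈ K, 0 ≤ D y) :
    {y ∈ K | D y = 0}.Nonempty := by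
  by_contra hne
  rw [Set.not_nonempty_iff_eq_empty] at hne
  have hKne : K.Nonempty := ⟨X 0, h.mapsTo 0 le_rfl⟩
  obtain ⟨y₀, hy₀, hmin⟩ := hK.exists_isMinOn hKne hD
  have hpos : 0 < D y₀ := lt_of_le_of_ne (hD0 y₀ hy₀) fun h0 => by
    have : y₀ ∈ {y ∈ K | D y = 0} := ⟨hy₀, h0.symm⟩
    rw [hne] at this
    exact this
  have ht := (Metric.tendsto_atTop.1 (h.tendsto_rate hK hF hV hD hD0)) (D y₀) hpos
  obtain ⟨N, hN⟩ := ht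
  have hN' := hN (max N 0) (le_max_left _ _)
  have h0 : 0 ≤ max N 0 := le_max_right _ _
  rw [Real.dist_eq, sub_zero, abs_of_nonneg (hD0 _ (h.mapsTo _ h0))] at hN'
  exact absurd (hmin (h.mapsTo _ h0)) (not_le.2 hN')

/-- **The curve approaches the zero set of the dissipation rate**:
`dist (X t, {y ∈ K | D y = 0}) → 0` [cite: GrossEtAl2019, Thm. 1 (proof, (38))]. On the compact set
of points of `K` at distance `≥ ε` from the zero set, `D` is positive, hence `≥ μ > 0`; by
`tendsto_rate` the curve eventually avoids it. -/
theorem tendsto_infDist_zeroSet (h : DissipativeCurve F V D K X) (hK : IsCompact K)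
    (hF : ContinuousOn F K) (hV : ContinuousOn V K) (hD : ContinuousOn D K)
    (hD0 : ∀ y ∈ K, 0 ≤ D y) :
    Tendsto (fun t => infDist (X t) {y ∈ K | D y = 0}) atTop (𝓝 0) := by
  set Z : Set E := {y ∈ K | D y = 0} with hZ
  rw [Metric.tendsto_atTop]
  intro ε hε
  set Kε : Set E := K ∩ (fun y => infDist y Z) ⁻¹' Ici ε with hKε
  have hKεc : IsCompact Kε := hK.inter_right
    (isClosed_Ici.preimage (continuous_infDist_pt Z))
  rcases Kε.eq_empty_or_nonempty with hemp | hne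
  · refine ⟨0, fun t ht => ?_⟩
    have hnot : X t ∉ Kε := by rw [hemp]; exact fun h => h
    rw [Real.dist_eq, sub_zero, abs_of_nonneg infDist_nonneg]
    by_contra hge
    exact hnot ⟨h.mapsTo t ht, not_lt.1 hge⟩
  · obtain ⟨y₀, hy₀, hmin⟩ := hKεc.exists_isMinOn hne (hD.mono inter_subset_left)
    have hpos : 0 < D y₀ := by
      refine lt_of_le_of_ne (hD0 y₀ hy₀.1) fun h0 => ?_
      have hz : y₀ ∈ Z := ⟨hy₀.1, h0.symm⟩
      have : infDist y₀ Z = 0 := infDist_zero_of_mem hz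
      have hge : ε ≤ infDist y₀ Z := hy₀.2
      linarith
    obtain ⟨N, hN⟩ := (Metric.tendsto_atTop.1 (h.tendsto_rate hK hF hV hD hD0)) (D y₀) hpos
    refine ⟨max N 0, fun t ht => ?_⟩
    have h0t : 0 ≤ t := (le_max_right N 0).trans ht
    have hDt := hN t ((le_max_left N 0).trans ht)
    rw [Real.dist_eq, sub_zero, abs_of_nonneg (hD0 _ (h.mapsTo t h0t))] at hDt
    rw [Real.dist_eq, sub_zero, abs_of_nonneg infDist_nonneg]
    by_contra hge
    have hmem : X t ∈ Kε := ⟨h.mapsTo t h0t, not_lt.1 hge⟩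
    exact absurd (hmin hmem) (not_le.2 hDt)

/-! ### §4 The attraction dichotomy between two closed pieces separated by a level of `V` -/

omit [NormedSpace ℝ E] in
/-- Separation step: if eventually `X t` lies in a compact `K' ⊆ Bᶜ` (`B` closed), the curve
approaches a nonempty set `Z ⊆ A ∪ B`, then it approaches `A` — a thickening of `K'` misses `B`, so
the nearby points of `Z` are points of `A`. [folklore] -/
private theorem tendsto_infDist_of_eventually_mem {K' A B Z : Set E} (hK' : IsCompact K')
    (hB : IsClosed B) (hK'B : K' ⊆ Bᶜ) (hZ : Z ⊆ A ∪ B) (hZne : Z.Nonempty)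
    (hev : ∀ᶠ t in atTop, X t ∈ K') (hlim : Tendsto (fun t => infDist (X t) Z) atTop (𝓝 0)) :
    Tendsto (fun t => infDist (X t) A) atTop (𝓝 0) := by
  obtain ⟨r, hr, hthick⟩ := hK'.exists_thickening_subset_open hB.isOpen_compl hK'B
  rw [Metric.tendsto_atTop] at hlim ⊢
  intro e he
  obtain ⟨N₁, hN₁⟩ := hlim (min e r) (lt_min he hr)
  obtain ⟨N₂, hN₂⟩ := Filter.eventually_atTop.1 hev
  refine ⟨max N₁ N₂, fun t ht => ?_⟩
  have h1 := hN₁ t ((le_max_left _ _).trans ht)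
  have h2 : X t ∈ K' := hN₂ t ((le_max_right _ _).trans ht)
  rw [Real.dist_eq, sub_zero, abs_of_nonneg infDist_nonneg] at h1 ⊢
  obtain ⟨z, hz, hdz⟩ := (infDist_lt_iff hZne).1 h1
  rcases hZ hz with hzA | hzB
  · exact (infDist_le_dist_of_mem hzA).trans_lt (hdz.trans_le (min_le_left _ _))
  · exfalso
    have hzt : z ∈ thickening r K' :=
      Metric.mem_thickening_iff.2 ⟨X t, h2, by rw [dist_comm]; exact hdz.trans_le (min_le_right _ _)⟩
    exact hthick hzt hzB

/-- **Sublevel region of attraction** [cite: GrossEtAl2019, Thm. 1 (proof: «∀x₀ ∉ Z_𝒰 :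
lim ‖φ_f(t,x₀)‖_𝒞 = 0»)]: let the zero set of `D` in `K` lie in `A ∪ B`, `B` closed with `b ≤ V` on
`B ∩ K`. If `V (X t₀) < b` at some `t₀ ≥ 0` (in particular if `V (X 0) < b`), then
`dist (X t, A) → 0`: from `t₀` on the curve lies in the compact piece `K ∩ {V ≤ V (X t₀)}`, which
misses `B`. -/
theorem tendsto_infDist_of_apply_lt (h : DissipativeCurve F V D K X) (hK : IsCompact K)
    (hF : ContinuousOn F K) (hV : ContinuousOn V K) (hD : ContinuousOn D K)
    (hD0 : ∀ y ∈ K, 0 ≤ D y) {A B : Set E} (hB : IsClosed B)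
    (hZ : {y ∈ K | D y = 0} ⊆ A ∪ B) {b : ℝ} (hb : ∀ y ∈ B ∩ K, b ≤ V y)
    {t₀ : ℝ} (ht₀ : 0 ≤ t₀) (hlt : V (X t₀) < b) :
    Tendsto (fun t => infDist (X t) A) atTop (𝓝 0) := by
  set K' : Set E := K ∩ V ⁻¹' Iic (V (X t₀)) with hK'
  have hK'c : IsCompact K' :=
    hK.of_isClosed_subset (hV.preimage_isClosed_of_isClosed hK.isClosed isClosed_Iic)
      inter_subset_left
  have hK'B : K' ⊆ Bᶜ := fun y hy hyB => by
    have := hb y ⟨hyB, hy.1⟩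
    have hle : V y ≤ V (X t₀) := hy.2
    linarith
  have hev : ∀ᶠ t in atTop, X t ∈ K' := Filter.eventually_atTop.2
    ⟨t₀, fun t ht => ⟨h.mapsTo t (ht₀.trans ht), h.apply_le_apply hD0 ht₀ ht⟩⟩
  exact tendsto_infDist_of_eventually_mem hK'c hB hK'B hZ (h.zeroSet_nonempty hK hF hV hD hD0) hev
    (h.tendsto_infDist_zeroSet hK hF hV hD hD0)

/-- **The attraction dichotomy** (deterministic content of [cite: GrossEtAl2019, Thm. 1]): let the zero
set of `D` in `K` lie in `A ∪ B` with `A`, `B` closed, `V ≤ a` on `A ∩ K`, `b ≤ V` on `B ∩ K` and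
`a < b`. Then `dist (X t, A) → 0` or `dist (X t, B) → 0`. (Either `V` drops below `b` at some time —
then `→ A` by `tendsto_infDist_of_apply_lt` — or `V ≥ b > a` forever and the curve lives in the
compact piece `K ∩ {b ≤ V}`, which misses `A`.) With `A = 𝒞`, `B = 𝒰`: a solution that does not
approach `𝒰` approaches `𝒞`. -/
theorem tendsto_infDist_or (h : DissipativeCurve F V D K X) (hK : IsCompact K)
    (hF : ContinuousOn F K) (hV : ContinuousOn V K) (hD : ContinuousOn D K)
    (hD0 : ∀ y ∈ K, 0 ≤ D y) {A B : Set E} (hA : IsClosed A) (hB : IsClosed B)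
    (hZ : {y ∈ K | D y = 0} ⊆ A ∪ B) {a b : ℝ} (hab : a < b) (ha : ∀ y ∈ A ∩ K, V y ≤ a)
    (hb : ∀ y ∈ B ∩ K, b ≤ V y) :
    Tendsto (fun t => infDist (X t) A) atTop (𝓝 0) ∨
      Tendsto (fun t => infDist (X t) B) atTop (𝓝 0) := by
  by_cases hlt : ∃ t₀, 0 ≤ t₀ ∧ V (X t₀) < b
  · obtain ⟨t₀, ht₀, hlt⟩ := hlt
    exact Or.inl (h.tendsto_infDist_of_apply_lt hK hF hV hD hD0 hB hZ hb ht₀ hlt)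
  · push Not at hlt
    right
    set K' : Set E := K ∩ V ⁻¹' Ici b with hK'
    have hK'c : IsCompact K' :=
      hK.of_isClosed_subset (hV.preimage_isClosed_of_isClosed hK.isClosed isClosed_Ici)
        inter_subset_left
    have hK'A : K' ⊆ Aᶜ := fun y hy hyA => by
      have := ha y ⟨hyA, hy.1⟩
      have hge : b ≤ V y := hy.2
      linarith
    have hev : ∀ᶠ t in atTop, X t ∈ K' :=
      Filter.eventually_atTop.2 ⟨0, fun t ht => ⟨h.mapsTo t ht, hlt t ht⟩⟩
    have hZ' : {y ∈ K | D y = 0} ⊆ B ∪ A := by rwa [union_comm]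
    exact tendsto_infDist_of_eventually_mem hK'c hA hK'A hZ' (h.zeroSet_nonempty hK hF hV hD hD0)
      hev (h.tendsto_infDist_zeroSet hK hF hV hD hD0)

/-- **Packaged form with a target set `𝒞` and an exceptional set `𝒰`** [cite: GrossEtAl2019, Thm. 1]:
`𝒞`, `𝒰` compact and disjoint, `V ≥ 0` on `K` with zero set exactly `𝒞 ∩ K` there, and the zero set
of the rate `D` in `K` contained in `𝒞 ∪ 𝒰`. Then (i) `dist (X t, 𝒞) → 0 ∨ dist (X t, 𝒰) → 0`, and
(ii) if `V (X 0) < V u` for every `u ∈ 𝒰 ∩ K`, then `dist (X t, 𝒞) → 0`. (The level `b` of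
`tendsto_infDist_or` is the minimum of `V` on the compact set `𝒰 ∩ K`, positive since `𝒰` misses the
zero set `𝒞`; `a = 0`.) -/
theorem tendsto_infDist_or_of_disjoint (h : DissipativeCurve F V D K X) (hK : IsCompact K)
    (hF : ContinuousOn F K) (hV : ContinuousOn V K) (hD : ContinuousOn D K)
    (hD0 : ∀ y ∈ K, 0 ≤ D y) {C U : Set E} (hC : IsCompact C) (hU : IsCompact U)
    (hCU : Disjoint C U) (hV0 : ∀ y ∈ K, 0 ≤ V y) (hVC : ∀ y ∈ K, V y = 0 ↔ y ∈ C)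
    (hZ : {y ∈ K | D y = 0} ⊆ C ∪ U) :
    (Tendsto (fun t => infDist (X t) C) atTop (𝓝 0) ∨
      Tendsto (fun t => infDist (X t) U) atTop (𝓝 0)) ∧
    ((∀ u ∈ U ∩ K, V (X 0) < V u) → Tendsto (fun t => infDist (X t) C) atTop (𝓝 0)) := by
  have ha : ∀ y ∈ C ∩ K, V y ≤ 0 := fun y hy => ((hVC y hy.2).2 hy.1).le
  -- the level of `U`
  have hUK : IsCompact (U ∩ K) := hU.inter_right hK.isClosed
  rcases (U ∩ K).eq_empty_or_nonempty with hemp | hne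
  · -- `U ∩ K = ∅`: the zero set lies in `C`, take `b = V (X 0) + 1`
    have hb : ∀ y ∈ U ∩ K, V (X 0) + 1 ≤ V y := fun y hy => by rw [hemp] at hy; exact hy.elim
    have hconv := h.tendsto_infDist_of_apply_lt hK hF hV hD hD0 hU.isClosed hZ hb le_rfl
      (by linarith)
    exact ⟨Or.inl hconv, fun _ => hconv⟩
  · obtain ⟨u₀, hu₀, hmin⟩ := hUK.exists_isMinOn hne (hV.mono inter_subset_right)
    have hb : ∀ y ∈ U ∩ K, V u₀ ≤ V y := fun y hy => hmin hy
    have hbpos : 0 < V u₀ := by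
      refine lt_of_le_of_ne (hV0 u₀ hu₀.2) fun h0 => ?_
      have hC' : u₀ ∈ C := (hVC u₀ hu₀.2).1 h0.symm
      exact hCU.ne_of_mem hC' hu₀.1 rfl
    refine ⟨h.tendsto_infDist_or hK hF hV hD hD0 hC.isClosed hU.isClosed hZ hbpos ha hb, ?_⟩
    intro hlt
    exact h.tendsto_infDist_of_apply_lt hK hF hV hD hD0 hU.isClosed hZ hb le_rfl (hlt u₀ hu₀)

end DissipativeCurve

/-! ### §5 Lyapunov stability of the compact zero set of `V` -/

omit [NormedSpace ℝ E] in
/-- **Lyapunov stability of a compact set from a Lyapunov function, uniformly over curves along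
which `V` does not increase** [cite: GrossEtAl2019, Thm. 1 (proof: «𝒞 is Lyapunov stable»)]: let
`V : E → ℝ` be continuous, `V ≥ 0`, with zero set the compact set `C`, and let some sublevel set
`{V ≤ c₀}`, `c₀ > 0`, be compact. Then for every `ε > 0` there is `δ > 0` such that every curve
`X` with `V (X t) ≤ V (X 0)` for `t ≥ 0` and `dist (X 0, C) < δ` satisfies `dist (X t, C) < ε` for
all `t ≥ 0`. (On the compact set `{V ≤ c₀} ∩ {dist(·, C) ≥ ε}` the function `V` has a positive
minimum `m`; `{V < m}` is an open neighbourhood of `C`, so contains a `δ`-thickening of it.) -/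
theorem exists_forall_infDist_lt {V : E → ℝ} {C : Set E} (hV : Continuous V) (hV0 : ∀ x, 0 ≤ V x)
    (hVC : ∀ x, V x = 0 ↔ x ∈ C) (hC : IsCompact C) {c₀ : ℝ} (hc₀ : 0 < c₀)
    (hK : IsCompact {x | V x ≤ c₀}) {ε : ℝ} (hε : 0 < ε) :
    ∃ δ > 0, ∀ X : ℝ → E, (∀ t, 0 ≤ t → V (X t) ≤ V (X 0)) → infDist (X 0) C < δ →
      ∀ t, 0 ≤ t → infDist (X t) C < ε := by
  rcases C.eq_empty_or_nonempty with hCe | hCne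
  · refine ⟨1, one_pos, fun X _ _ t _ => ?_⟩
    rw [hCe, infDist_empty]; exact hε
  -- a level `m > 0` below which points are `ε`-close to `C`
  set A : Set E := {x | V x ≤ c₀} ∩ (fun x => infDist x C) ⁻¹' Ici ε with hA
  have hAc : IsCompact A := hK.inter_right (isClosed_Ici.preimage (continuous_infDist_pt C))
  obtain ⟨m, hm, hmA⟩ : ∃ m > 0, m ≤ c₀ ∧ ∀ x ∈ A, m ≤ V x := by
    rcases A.eq_empty_or_nonempty with hAe | hAne
    · exact ⟨c₀, hc₀, le_rfl, fun x hx => by rw [hAe] at hx; exact hx.elim⟩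
    · obtain ⟨x₀, hx₀, hmin⟩ := hAc.exists_isMinOn hAne hV.continuousOn
      have hpos : 0 < V x₀ := by
        refine lt_of_le_of_ne (hV0 x₀) fun h0 => ?_
        have hxC : x₀ ∈ C := (hVC x₀).1 h0.symm
        have : infDist x₀ C = 0 := infDist_zero_of_mem hxC
        have hge : ε ≤ infDist x₀ C := hx₀.2
        linarith
      exact ⟨min (V x₀) c₀, lt_min hpos hc₀, min_le_right _ _,
        fun x hx => (min_le_left _ _).trans (hmin hx)⟩
  have hclose : ∀ x, V x < m → infDist x C < ε := by
    intro x hx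
    by_contra hge
    have hxA : x ∈ A := ⟨(hx.le.trans hmA.1), not_lt.1 hge⟩
    exact absurd (hmA.2 x hxA) (not_le.2 hx)
  -- `{V < m}` is an open neighbourhood of `C`; take a thickening inside it
  have hopen : IsOpen (V ⁻¹' Iio m) := isOpen_Iio.preimage hV
  have hCsub : C ⊆ V ⁻¹' Iio m := fun x hx => by
    have : V x = 0 := (hVC x).2 hx
    show V x < m; linarith
  obtain ⟨δ, hδ, hthick⟩ := hC.exists_thickening_subset_open hopen hCsub
  refine ⟨δ, hδ, fun X hmono h0 t ht => hclose _ ?_⟩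
  have hX0 : X 0 ∈ thickening δ C := (mem_thickening_iff_infDist_lt hCne).2 h0
  have hV0m : V (X 0) < m := hthick hX0
  exact (hmono t ht).trans_lt hV0m

/-! ### §6 Readouts along a curve approaching a compact set (append 2026-08-27, same sources)

[GrossEtAl2019, §III Def. 3 / §IV-A]: asymptotic stability «with respect to 𝒞» is convergence of the
point-to-set distance `‖φ_f(t,x₀)‖_𝒞 → 0`; the printed reading of it («they also satisfy all control
objectives», p0005 L14–L15) is that every continuous quantity which takes a constant value on the
compact set `𝒞` converges to that value along the trajectory. The lemma below is exactly this step
(uniform continuity on a compact thickening of `𝒞`), for any filter and any proper metric space. -/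

/-- **Readouts converge along a curve approaching a compact set**: if `f` is continuous, constant `= c`
on the nonempty compact set `C` of a proper metric space, and `dist(γ(t), C) → 0` along a filter, then
`f(γ(t)) → c`. [cite: GrossEtAl2019, §III Definition 3 with §IV-A («they also satisfy all control
objectives»)] -/
theorem tendsto_comp_of_tendsto_infDist {X Y : Type*} [MetricSpace X] [ProperSpace X] [MetricSpace Y]
    {C : Set X} (hC : IsCompact C) (hne : C.Nonempty) {f : X → Y} (hf : Continuous f) {c : Y}
    (hfc : ∀ y ∈ C, f y = c) {ι : Type*} {l : Filter ι} {γ : ι → X}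
    (hγ : Tendsto (fun t => infDist (γ t) C) l (𝓝 0)) :
    Tendsto (fun t => f (γ t)) l (𝓝 c) := by
  rw [Metric.tendsto_nhds]
  intro ε hε
  have hK : IsCompact (cthickening 1 C) := hC.cthickening
  have huc := hK.uniformContinuousOn_of_continuous hf.continuousOn
  obtain ⟨δ, hδ, hδε⟩ := Metric.uniformContinuousOn_iff.1 huc ε hε
  have hev : ∀ᶠ t in l, infDist (γ t) C < min δ 1 :=
    (tendsto_order.1 hγ).2 _ (lt_min hδ one_pos)
  refine hev.mono fun t ht => ?_
  obtain ⟨y, hyC, hy⟩ := (Metric.infDist_lt_iff hne).1 ht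
  have hx : γ t ∈ cthickening 1 C :=
    mem_cthickening_of_dist_le (γ t) y 1 C hyC (le_of_lt (lt_of_lt_of_le hy (min_le_right _ _)))
  have hyK : y ∈ cthickening 1 C := self_subset_cthickening C hyC
  have := hδε (γ t) hx y hyK (lt_of_lt_of_le hy (min_le_left _ _))
  rw [hfc y hyC] at this
  exact this

end Literature.Analysis.ODE
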